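import Literature.Probability.Percolation.StripFill
import HarnessLib

/-!
# The windows of the strips: filling, swallowing, and disjointness

Topic `Probability/Percolation`.  Support file (definitions and proofs, no named fact) for the zone
geometry of the proof of Schramm–Smirnov's Prop. 4.1 (Ann. Probab. 39 (2011), §4), per-strip form.
The data (`StripData`): finitely many STRIPS `S k` (finite 4-connected sets of coarse blocks — the
thickened tubes of the pieces of the cut between consecutive junction squares), pairwise disjoint
and not 4-adjacent, and finitely many CORES `C c` (the junction squares: boxes, pairwise at
sup-distance `≥ 2`, disjoint from the strips).  For a strip `k`: its adjacent cores `adjC k`, its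
GENERATOR `gen k = S k ∪ ⋃ adjacent cores`, its filling `F k = fill (gen k)` (everything the strip and
its cores enclose), its EXCISED cores `sqC k` (adjacent cores touching the outside of `F k`) and its
WINDOW `window k = F k ∖ ⋃ sqC k` (the strip, the pockets, and the absorbed cores).  A strip is
DOMINATED if its filling lies strictly inside another one (ties broken by the index); the maximal
strips carry the construction:

* `window_conn` — a window is 4-connected (every pocket touches the strip: a pocket rimmed by cores
  alone would have its top-left block inside a core, `exists_mem_S_oneStep_of_pocket`);
* `out_of_mem_S` — a maximal strip escapes the generator of every other maximal strip;
* `disjoint_window`, `not_oneStep_window` — the windows of distinct maximal strips are disjoint and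
  not 4-adjacent;
* `sqC_of_sqC_of_adjC` — a core excised for one maximal strip and adjacent to another is excised for
  it too (the excised squares are globally consistent); `not_adjC_of_absorbed` — absorbed cores are
  private;
* `exists_maximal` — every strip lies in the filling of a maximal one.

## References

* O. Schramm, S. Smirnov, Ann. Probab. 39 (2011), arXiv:1101.5820, §4, proof of Prop. 4.1 (the
  strips `K_j` and the discs `B(x_i, s)` at the junctions). [SchrammSmirnov2011]
-/

noncomputable section

open Set Relation
open scoped Classical

namespace Literature.Probability.Percolation

namespace FineBlocks

variable {X : Finset (ℤ × ℤ)} {a b : ℤ × ℤ}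

/-- A block outside `X` next to a non-escaping block outside `X` does not escape. [folklore] -/
theorem not_out_of_oneStep (ha : a ∉ X) (hna : ¬ Out X a) (hab : OneStep a b) (hb : b ∉ X) : ¬ Out X b :=
  fun h => hna (Out.of_conn (conn_single ha hb hab) h)

/-- A block next to a non-escaping block outside `X` is in `X` or does not escape. [folklore] -/
theorem mem_or_not_out_of_oneStep (ha : a ∉ X) (hna : ¬ Out X a) (hab : OneStep a b) : b ∈ X ∨ ¬ Out X b := by
  by_cases hb : b ∈ X
  · exact Or.inl hb
  · exact Or.inr (not_out_of_oneStep ha hna hab hb)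

/-- **The strip data**: strips (finite 4-connected nonempty sets of blocks, pairwise disjoint and not
4-adjacent — e.g. distinct 4-components of one set) and cores (boxes, pairwise at sup-distance `≥ 2`,
disjoint from the strips, 4-connected).
[cite: SchrammSmirnov2011, §4, proof of Prop. 4.1 (the strips K_j and the discs at the junctions)] -/
structure StripData where
  /-- number of strips -/
  n : ℕ
  /-- number of cores -/
  m : ℕ
  /-- the strips -/
  S : Fin n → Finset (ℤ × ℤ)
  /-- the cores -/
  C : Fin m → Finset (ℤ × ℤ)
  S_conn : ∀ k, ∀ a ∈ S k, ∀ b ∈ S k, Conn ↑(S k) a b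
  S_nonempty : ∀ k, (S k).Nonempty
  S_sep : ∀ k j, k ≠ j → ∀ a ∈ S k, ∀ b ∈ S j, a ≠ b ∧ ¬ OneStep a b
  S_C : ∀ k c, ∀ a ∈ S k, a ∉ C c
  C_sep : ∀ c c', c ≠ c' → ∀ a ∈ C c, ∀ b ∈ C c', ¬ Near a b
  C_box : ∀ c, ∀ x y : ℤ, (x, y + 1) ∈ C c → (x - 1, y) ∈ C c → (x, y) ∈ C c
  C_conn : ∀ c, ∀ a ∈ C c, ∀ b ∈ C c, Conn ↑(C c) a b

namespace StripData

variable (𝔖 : StripData)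

/-- The cores 4-adjacent to strip `k`. [folklore] -/
def adjC (k : Fin 𝔖.n) : Finset (Fin 𝔖.m) := Finset.univ.filter fun c => ∃ s ∈ 𝔖.S k, ∃ x ∈ 𝔖.C c, OneStep s x

/-- **The generator** of strip `k`: the strip and its adjacent cores. [folklore] -/
def gen (k : Fin 𝔖.n) : Finset (ℤ × ℤ) := 𝔖.S k ∪ (𝔖.adjC k).biUnion 𝔖.C

/-- **The filling** of strip `k`. [folklore] -/
def F (k : Fin 𝔖.n) : Finset (ℤ × ℤ) := fill (𝔖.gen k)

/-- **The excised cores** of strip `k`: adjacent cores next to an escaping block. [folklore] -/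
def sqC (k : Fin 𝔖.n) : Finset (Fin 𝔖.m) :=
  (𝔖.adjC k).filter fun c => ∃ x ∈ 𝔖.C c, ∃ y, OneStep x y ∧ Out (𝔖.gen k) y

/-- **The window** of strip `k`: its filling minus its excised cores. [cite: SchrammSmirnov2011, §4, proof of Prop. 4.1 (the strip together with the neighbourhood of α it bounds)] -/
def window (k : Fin 𝔖.n) : Finset (ℤ × ℤ) := 𝔖.F k \ (𝔖.sqC k).biUnion 𝔖.C

variable {𝔖} {k j : Fin 𝔖.n} {c c' : Fin 𝔖.m} {a b : ℤ × ℤ}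

/-- `mem_adjC_iff` (mem adjC iff). [folklore] -/
theorem mem_adjC_iff : c ∈ 𝔖.adjC k ↔ ∃ s ∈ 𝔖.S k, ∃ x ∈ 𝔖.C c, OneStep s x := by
  simp [adjC]

/-- `mem_gen_iff` (mem gen iff). [folklore] -/
theorem mem_gen_iff : a ∈ 𝔖.gen k ↔ a ∈ 𝔖.S k ∨ ∃ c ∈ 𝔖.adjC k, a ∈ 𝔖.C c := by
  simp [gen]

/-- `mem_sqC_iff` (mem sqC iff). [folklore] -/
theorem mem_sqC_iff : c ∈ 𝔖.sqC k ↔ c ∈ 𝔖.adjC k ∧ ∃ x ∈ 𝔖.C c, ∃ y, OneStep x y ∧ Out (𝔖.gen k) y := by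
  simp [sqC]

/-- `mem_window_iff` (mem window iff). [folklore] -/
theorem mem_window_iff : a ∈ 𝔖.window k ↔ ¬ Out (𝔖.gen k) a ∧ ∀ c ∈ 𝔖.sqC k, a ∉ 𝔖.C c := by
  simp [window, F, mem_fill_iff]

/-- `S_subset_gen` (S subset gen). [folklore] -/
theorem S_subset_gen : 𝔖.S k ⊆ 𝔖.gen k := fun _ h => mem_gen_iff.2 (Or.inl h)

/-- `C_subset_gen` (C subset gen). [folklore] -/
theorem C_subset_gen (hc : c ∈ 𝔖.adjC k) : 𝔖.C c ⊆ 𝔖.gen k := fun _ h => mem_gen_iff.2 (Or.inr ⟨c, hc, h⟩)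

/-- Blocks of different cores are not near; so near core blocks lie in one core. [folklore] -/
theorem core_eq_of_near (ha : a ∈ 𝔖.C c) (hb : b ∈ 𝔖.C c') (h : Near a b) : c = c' := by
  by_contra hne; exact 𝔖.C_sep c c' hne a ha b hb h

/-- A strip block is in no other strip. [folklore] -/
theorem not_mem_S_of_mem_S (hkj : k ≠ j) (ha : a ∈ 𝔖.S k) : a ∉ 𝔖.S j :=
  fun h => (𝔖.S_sep k j hkj a ha a h).1 rfl

/-- A strip block is not in the generator of another strip. [folklore] -/
theorem not_mem_gen_of_mem_S (hkj : k ≠ j) (ha : a ∈ 𝔖.S k) : a ∉ 𝔖.gen j := by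
  rw [mem_gen_iff]
  rintro (h | ⟨c, -, hc⟩)
  · exact not_mem_S_of_mem_S hkj ha h
  · exact 𝔖.S_C k c a ha hc

/-- Strip blocks do not escape their own generator. [folklore] -/
theorem not_out_of_mem_S (ha : a ∈ 𝔖.S k) : ¬ Out (𝔖.gen k) a := fun h => h.not_mem (S_subset_gen ha)

/-- The strip lies in its window. [folklore] -/
theorem S_subset_window : 𝔖.S k ⊆ 𝔖.window k := fun a ha =>
  mem_window_iff.2 ⟨not_out_of_mem_S ha, fun c _ h => 𝔖.S_C k c a ha h⟩

/-! ### Pockets touch the strip -/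

/-- **Every pocket touches the strip**: from a block outside the generator that does not escape, a
chain of such blocks leads to one 4-adjacent to a block of the strip.  (The component of the pocket
is finite; at its top-left block the blocks above and to the left are in the generator; if both were
core blocks they would be near, hence in ONE core, a box, which would then contain the top-left
block itself.) [folklore] -/
theorem exists_mem_S_oneStep_of_pocket (ha : a ∉ 𝔖.gen k) (hna : ¬ Out (𝔖.gen k) a) :
    ∃ p s, Conn (↑(𝔖.gen k))ᶜ a p ∧ s ∈ 𝔖.S k ∧ OneStep p s := by
  -- the component of `a` outside the generator, as a finite set
  set P : Finset (ℤ × ℤ) := (bbox (𝔖.gen k)).filter fun z => Conn (↑(𝔖.gen k))ᶜ a z with hP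
  have memP : ∀ {z}, z ∈ P ↔ Conn (↑(𝔖.gen k))ᶜ a z := by
    intro z
    rw [hP, Finset.mem_filter]
    exact ⟨fun h => h.2, fun h => ⟨mem_bbox_of_not_out fun hz => hna (Out.of_conn h hz), h⟩⟩
  have notgen : ∀ {z}, z ∈ P → z ∉ 𝔖.gen k := fun hz => by
    rcases (memP.1 hz).mem_or_eq with h | rfl
    exacts [h, ha]
  have notout : ∀ {z}, z ∈ P → ¬ Out (𝔖.gen k) z := fun hz h => hna (Out.of_conn (memP.1 hz) h)
  -- neighbours of `P` outside `P` are in the generator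
  have rim : ∀ {z w}, z ∈ P → OneStep z w → w ∉ P → w ∈ 𝔖.gen k := by
    intro z w hz hzw hw
    by_contra hwg
    exact hw (memP.2 ((memP.1 hz).trans (conn_single (notgen hz) hwg hzw)))
  obtain ⟨q, hq, htop, hleft⟩ := exists_top_left (P := P) ⟨a, memP.2 conn_refl⟩
  have hu : (q.1, q.2 + 1) ∉ P := fun h => by have := htop _ h; simp only at this; omega
  have hu' := rim hq (oneStep_up q) hu
  have hl' := rim hq (oneStep_left q) hleft
  -- one of the two is a strip block
  rcases mem_gen_iff.1 hu' with hS | ⟨c, hc, hcu⟩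
  · exact ⟨q, _, memP.1 hq, hS, oneStep_up q⟩
  rcases mem_gen_iff.1 hl' with hS | ⟨c', -, hcl⟩
  · exact ⟨q, _, memP.1 hq, hS, oneStep_left q⟩
  exfalso
  have hcc' : c = c' := core_eq_of_near hcu hcl ⟨by simp, by simp⟩
  subst hcc'
  have hqC : q ∈ 𝔖.C c := by
    have := 𝔖.C_box c q.1 q.2 hcu hcl
    simpa using this
  exact notgen hq (C_subset_gen hc hqC)

/-- **The window is 4-connected.** [folklore] -/
theorem window_conn : ∀ a ∈ 𝔖.window k, ∀ b ∈ 𝔖.window k, Conn ↑(𝔖.window k) a b := by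
  -- every window block is joined inside the window to a strip block
  have toS : ∀ a ∈ 𝔖.window k, ∃ s ∈ 𝔖.S k, Conn ↑(𝔖.window k) a s := by
    intro a ha
    obtain ⟨hna, hsq⟩ := mem_window_iff.1 ha
    by_cases hag : a ∈ 𝔖.gen k
    · rcases mem_gen_iff.1 hag with hS | ⟨c, hc, hac⟩
      · exact ⟨a, hS, conn_refl⟩
      · -- an absorbed core: walk inside the core to a block next to the strip
        have hcsq : c ∉ 𝔖.sqC k := fun h => hsq c h hac
        obtain ⟨s, hs, x, hx, hsx⟩ := mem_adjC_iff.1 hc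
        have hC : ∀ z ∈ 𝔖.C c, z ∈ 𝔖.window k := fun z hz =>
          mem_window_iff.2 ⟨fun h => h.not_mem (C_subset_gen hc hz), fun c' hc' hzc' => by
            have := core_eq_of_near hz hzc' (near_refl z); subst this; exact hcsq hc'⟩
        refine ⟨s, hs, ((𝔖.C_conn c a hac x hx).mono fun z hz => ?_).trans
          (conn_single (hC x hx) (S_subset_window hs) hsx.symm)⟩
        exact hC z hz
    · obtain ⟨p, s, hap, hs, hps⟩ := exists_mem_S_oneStep_of_pocket hag hna
      -- the pocket chain stays in the window
      have hP : ∀ {z}, Conn (↑(𝔖.gen k))ᶜ a z → z ∈ 𝔖.window k := fun hz =>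
        mem_window_iff.2 ⟨fun h => hna (Out.of_conn hz h), fun c hc hzc =>
          (hz.mem (show a ∈ (↑(𝔖.gen k) : Set (ℤ × ℤ))ᶜ from hag)) (C_subset_gen (mem_sqC_iff.1 hc).1 hzc)⟩
      refine ⟨s, hs, ?_⟩
      have h1 : Conn ↑(𝔖.window k) a p := by
        refine hap.head_induction (P := fun z => Conn ↑(𝔖.window k) z p) conn_refl
          fun x y hx hy hxy hyp ih => ?_
        have hay : Conn (↑(𝔖.gen k))ᶜ a y := hap.trans hyp.symm
        have hax : Conn (↑(𝔖.gen k))ᶜ a x := hay.trans (conn_single hy hx hxy.symm)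
        exact (conn_single (hP hax) (hP hay) hxy).trans ih
      exact h1.trans (conn_single (hP hap) (S_subset_window hs) hps)
  intro a ha b hb
  obtain ⟨s, hs, has⟩ := toS a ha
  obtain ⟨s', hs', hbs'⟩ := toS b hb
  exact (has.trans ((𝔖.S_conn k s hs s' hs').mono fun z hz => S_subset_window hz)).trans hbs'.symm

/-! ### Domination and maximal strips -/

/-- Strip `k` is **dominated** by strip `j`: its filling is strictly inside, or equal with a smaller
index for `j`. [folklore] -/
def Dom (𝔖 : StripData) (k j : Fin 𝔖.n) : Prop := 𝔖.F k ⊂ 𝔖.F j ∨ (𝔖.F k = 𝔖.F j ∧ j < k)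

/-- **Maximal strips**: dominated by none. [folklore] -/
def Maximal (𝔖 : StripData) (k : Fin 𝔖.n) : Prop := ∀ j, ¬ 𝔖.Dom k j

/-- **Every strip lies in the filling of a maximal strip.** [folklore] -/
theorem exists_maximal (k : Fin 𝔖.n) : ∃ j, 𝔖.Maximal j ∧ 𝔖.F k ⊆ 𝔖.F j := by
  -- maximise the cardinality of the filling, then minimise the index
  set A : Finset (Fin 𝔖.n) := Finset.univ.filter fun j => 𝔖.F k ⊆ 𝔖.F j with hA
  have hkA : k ∈ A := Finset.mem_filter.2 ⟨Finset.mem_univ _, subset_rfl⟩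
  obtain ⟨j₀, hj₀, hmax⟩ := A.exists_max_image (fun j => (𝔖.F j).card) ⟨k, hkA⟩
  set B : Finset (Fin 𝔖.n) := A.filter fun j => (𝔖.F j).card = (𝔖.F j₀).card with hB
  obtain ⟨j, hj, hmin⟩ := B.exists_min_image id ⟨j₀, Finset.mem_filter.2 ⟨hj₀, rfl⟩⟩
  obtain ⟨hjA, hjcard⟩ := Finset.mem_filter.1 hj
  have hkj : 𝔖.F k ⊆ 𝔖.F j := (Finset.mem_filter.1 hjA).2
  refine ⟨j, fun j' hdom => ?_, hkj⟩
  rcases hdom with hss | ⟨heq, hlt⟩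
  · have hj'A : j' ∈ A := Finset.mem_filter.2 ⟨Finset.mem_univ _, hkj.trans hss.1⟩
    have := hmax j' hj'A
    rw [← hjcard] at this
    exact absurd (Finset.card_lt_card hss) (not_lt.2 this)
  · have hj'A : j' ∈ A := Finset.mem_filter.2 ⟨Finset.mem_univ _, heq ▸ hkj⟩
    have hj'B : j' ∈ B := Finset.mem_filter.2 ⟨hj'A, by rw [← heq, hjcard]⟩
    exact absurd (hmin j' hj'B) (not_le.2 hlt)

/-- If a strip does not escape the generator of another strip, its filling lies inside the other's.
[folklore] -/
theorem F_subset_F_of_not_out (hkj : k ≠ j) {s : ℤ × ℤ} (hs : s ∈ 𝔖.S k) (hns : ¬ Out (𝔖.gen j) s) :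
    𝔖.F k ⊆ 𝔖.F j := by
  apply fill_subset_fill
  -- the whole strip, and its adjacent cores, are inside `fill (gen j)`
  have hS : ∀ s' ∈ 𝔖.S k, ¬ Out (𝔖.gen j) s' := by
    intro s' hs' h
    have hc := (𝔖.S_conn k s hs s' hs').mono (T := (↑(𝔖.gen j))ᶜ) fun z hz => not_mem_gen_of_mem_S hkj hz
    exact hns (Out.of_conn hc h)
  intro a ha
  rw [mem_fill_iff]
  rcases mem_gen_iff.1 ha with haS | ⟨c, hc, hac⟩
  · exact hS a haS
  · by_cases hcj : c ∈ 𝔖.adjC j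
    · exact fun h => h.not_mem (C_subset_gen hcj hac)
    · -- a core not adjacent to strip `j` is disjoint from `gen j`, connected, next to the strip
      obtain ⟨s', hs', x, hx, hs'x⟩ := mem_adjC_iff.1 hc
      have hCout : ∀ z ∈ 𝔖.C c, z ∉ 𝔖.gen j := by
        intro z hz hzg
        rcases mem_gen_iff.1 hzg with hzS | ⟨c', hc', hzc'⟩
        · exact 𝔖.S_C j c z hzS hz
        · have := core_eq_of_near hz hzc' (near_refl z); subst this; exact hcj hc'
      have hx' : ¬ Out (𝔖.gen j) x :=
        not_out_of_oneStep (not_mem_gen_of_mem_S hkj hs') (hS s' hs') hs'x (hCout x hx)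
      intro h
      exact hx' (Out.of_conn ((𝔖.C_conn c x hx a hac).mono fun z hz => hCout z hz) h)

/-- **A maximal strip escapes the generator of every other maximal strip.** [folklore] -/
theorem out_of_mem_S (hk : 𝔖.Maximal k) (hj : 𝔖.Maximal j) (hkj : k ≠ j) {s : ℤ × ℤ} (hs : s ∈ 𝔖.S k) :
    Out (𝔖.gen j) s := by
  by_contra hns
  have hsub := F_subset_F_of_not_out hkj hs hns
  rcases hsub.eq_or_ssubset with heq | hss
  · rcases lt_or_gt_of_ne hkj with hlt | hlt
    · exact hj k (Or.inr ⟨heq.symm, hlt⟩)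
    · exact hk j (Or.inr ⟨heq, hlt⟩)
  · exact hk j (Or.inl hss)

/-- A core adjacent to a maximal strip and not adjacent to another maximal strip is, from the latter,
entirely escaping. [folklore] -/
theorem out_of_mem_C (hk : 𝔖.Maximal k) (hj : 𝔖.Maximal j) (hkj : k ≠ j) (hc : c ∈ 𝔖.adjC k)
    (hcj : c ∉ 𝔖.adjC j) (ha : a ∈ 𝔖.C c) : Out (𝔖.gen j) a := by
  obtain ⟨s, hs, x, hx, hsx⟩ := mem_adjC_iff.1 hc
  have hCout : ∀ z ∈ 𝔖.C c, z ∉ 𝔖.gen j := by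
    intro z hz hzg
    rcases mem_gen_iff.1 hzg with hzS | ⟨c', hc', hzc'⟩
    · exact 𝔖.S_C j c z hzS hz
    · have := core_eq_of_near hz hzc' (near_refl z); subst this; exact hcj hc'
  have hx' : Out (𝔖.gen j) x :=
    Out.of_conn (conn_single (hCout x hx) (not_mem_gen_of_mem_S hkj hs) hsx.symm) (out_of_mem_S hk hj hkj hs)
  exact Out.of_conn ((𝔖.C_conn c a ha x hx).mono fun z hz => hCout z hz) hx'

/-- **Excision is consistent**: a core excised for a maximal strip and adjacent to another maximal
strip is excised for it too. [folklore] -/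
theorem sqC_of_sqC_of_adjC (hk : 𝔖.Maximal k) (hj : 𝔖.Maximal j) (hkj : k ≠ j) (hck : c ∈ 𝔖.sqC k)
    (hcj : c ∈ 𝔖.adjC j) : c ∈ 𝔖.sqC j := by
  obtain ⟨hc, -⟩ := mem_sqC_iff.1 hck
  obtain ⟨s, hs, x, hx, hsx⟩ := mem_adjC_iff.1 hc
  exact mem_sqC_iff.2 ⟨hcj, x, hx, s, hsx.symm, out_of_mem_S hk hj hkj hs⟩

/-- **Absorbed cores are private**: a core adjacent to a maximal strip but not excised for it is
adjacent to no other maximal strip. [folklore] -/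
theorem not_adjC_of_absorbed (hk : 𝔖.Maximal k) (hj : 𝔖.Maximal j) (hkj : k ≠ j) (hc : c ∈ 𝔖.adjC k)
    (hcsq : c ∉ 𝔖.sqC k) : c ∉ 𝔖.adjC j := by
  intro hcj
  obtain ⟨s, hs, x, hx, hsx⟩ := mem_adjC_iff.1 hcj
  exact hcsq (mem_sqC_iff.2 ⟨hc, x, hx, s, hsx.symm, out_of_mem_S hj hk hkj.symm hs⟩)

/-- Classification of a window block: strip, absorbed core, or pocket. [folklore] -/
theorem window_cases (ha : a ∈ 𝔖.window k) :
    a ∈ 𝔖.S k ∨ (∃ c ∈ 𝔖.adjC k, c ∉ 𝔖.sqC k ∧ a ∈ 𝔖.C c) ∨ (a ∉ 𝔖.gen k ∧ ¬ Out (𝔖.gen k) a) := by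
  obtain ⟨hna, hsq⟩ := mem_window_iff.1 ha
  by_cases hag : a ∈ 𝔖.gen k
  · rcases mem_gen_iff.1 hag with h | ⟨c, hc, hac⟩
    · exact Or.inl h
    · exact Or.inr (Or.inl ⟨c, hc, fun h => hsq c h hac, hac⟩)
  · exact Or.inr (Or.inr ⟨hag, hna⟩)

/-- A pocket block of a maximal strip is not in the generator of another maximal strip. [folklore] -/
theorem not_mem_gen_of_pocket (hk : 𝔖.Maximal k) (hj : 𝔖.Maximal j) (hkj : k ≠ j) (hag : a ∉ 𝔖.gen k)
    (hna : ¬ Out (𝔖.gen k) a) : a ∉ 𝔖.gen j := by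
  intro haj
  rcases mem_gen_iff.1 haj with hS | ⟨c, hc, hac⟩
  · exact hna (out_of_mem_S hj hk hkj.symm hS)
  · by_cases hck : c ∈ 𝔖.adjC k
    · exact hag (C_subset_gen hck hac)
    · exact hna (out_of_mem_C hj hk hkj.symm hc hck hac)

/-- A pocket block of a maximal strip escapes the generator of every other maximal strip. [folklore] -/
theorem out_of_pocket (hk : 𝔖.Maximal k) (hj : 𝔖.Maximal j) (hkj : k ≠ j) (hag : a ∉ 𝔖.gen k)
    (hna : ¬ Out (𝔖.gen k) a) : Out (𝔖.gen j) a := by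
  by_contra hnj
  -- the pocket touches the strip `k` at `s`; the touching chain stays outside `gen j`
  obtain ⟨p, s, hap, hs, hps⟩ := exists_mem_S_oneStep_of_pocket hag hna
  have key : ∀ {z}, Conn (↑(𝔖.gen k))ᶜ a z → z ∉ 𝔖.gen j ∧ ¬ Out (𝔖.gen j) z := by
    intro z hz
    refine hz.symm.head_induction (P := fun w => w ∉ 𝔖.gen j ∧ ¬ Out (𝔖.gen j) w)
      ⟨not_mem_gen_of_pocket hk hj hkj hag hna, hnj⟩ fun x y hx hy hxy hya ih => ?_
    have hax : Conn (↑(𝔖.gen k))ᶜ a x := hya.symm.trans (conn_single hy hx hxy.symm)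
    have hxk : ¬ Out (𝔖.gen k) x := fun h => hna (Out.of_conn hax h)
    have hxj := not_mem_gen_of_pocket hk hj hkj hx hxk
    exact ⟨hxj, not_out_of_oneStep ih.1 ih.2 hxy.symm hxj⟩
  obtain ⟨hpj, hpout⟩ := key hap
  exact not_out_of_oneStep hpj hpout hps (not_mem_gen_of_mem_S hkj hs) (out_of_mem_S hk hj hkj hs)

/-- **Every block of the window of a maximal strip escapes the generator of every other maximal
strip.** [folklore] -/
theorem out_of_mem_window (hk : 𝔖.Maximal k) (hj : 𝔖.Maximal j) (hkj : k ≠ j) (ha : a ∈ 𝔖.window k) :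
    Out (𝔖.gen j) a := by
  rcases window_cases ha with hS | ⟨c, hc, hcsq, hac⟩ | ⟨hag, hna⟩
  · exact out_of_mem_S hk hj hkj hS
  · exact out_of_mem_C hk hj hkj hc (not_adjC_of_absorbed hk hj hkj hc hcsq) hac
  · exact out_of_pocket hk hj hkj hag hna

/-- **The windows of distinct maximal strips are disjoint.** [folklore] -/
theorem disjoint_window (hk : 𝔖.Maximal k) (hj : 𝔖.Maximal j) (hkj : k ≠ j) :
    Disjoint (𝔖.window k) (𝔖.window j) :=
  Finset.disjoint_left.2 fun _ ha hb => (mem_window_iff.1 hb).1 (out_of_mem_window hk hj hkj ha)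

/-- A window block next to an escaping block is a strip block or an absorbed core block. [folklore] -/
theorem mem_S_or_absorbed_of_oneStep_out (hb : b ∈ 𝔖.window k) (ha : Out (𝔖.gen k) a) (hab : OneStep a b) :
    b ∈ 𝔖.S k ∨ ∃ c ∈ 𝔖.adjC k, c ∉ 𝔖.sqC k ∧ b ∈ 𝔖.C c := by
  rcases window_cases hb with hS | h | ⟨hbg, hnb⟩
  · exact Or.inl hS
  · exact Or.inr h
  · exact absurd ha (not_out_of_oneStep hbg hnb hab.symm ha.not_mem)

/-- **The windows of distinct maximal strips are not 4-adjacent.** [folklore] -/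
theorem not_oneStep_window (hk : 𝔖.Maximal k) (hj : 𝔖.Maximal j) (hkj : k ≠ j) (ha : a ∈ 𝔖.window k)
    (hb : b ∈ 𝔖.window j) : ¬ OneStep a b := by
  intro hab
  have haj := out_of_mem_window hk hj hkj ha
  have hbk := out_of_mem_window hj hk hkj.symm hb
  rcases mem_S_or_absorbed_of_oneStep_out hb haj hab with hbS | ⟨c, hc, hcsq, hbc⟩
  · rcases mem_S_or_absorbed_of_oneStep_out ha hbk hab.symm with haS | ⟨c', hc', hc'sq, hac'⟩
    · exact (𝔖.S_sep k j hkj a haS b hbS).2 hab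
    · exact not_adjC_of_absorbed hk hj hkj hc' hc'sq (mem_adjC_iff.2 ⟨b, hbS, a, hac', hab.symm⟩)
  · rcases mem_S_or_absorbed_of_oneStep_out ha hbk hab.symm with haS | ⟨c', hc', -, hac'⟩
    · exact not_adjC_of_absorbed hj hk hkj.symm hc hcsq (mem_adjC_iff.2 ⟨a, haS, b, hbc, hab⟩)
    · have := core_eq_of_near hac' hbc hab.near
      subst this
      exact not_adjC_of_absorbed hj hk hkj.symm hc hcsq hc'

/-! ### The outside of a window -/

/-- `mem_F_iff` (mem F iff). [folklore] -/
theorem mem_F_iff : a ∈ 𝔖.F k ↔ ¬ Out (𝔖.gen k) a := mem_fill_iff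

/-- The filling is the window plus the excised cores. [folklore] -/
theorem mem_F_iff' : a ∈ 𝔖.F k ↔ a ∈ 𝔖.window k ∨ ∃ c ∈ 𝔖.sqC k, a ∈ 𝔖.C c := by
  rw [mem_window_iff, mem_F_iff]
  constructor
  · intro h
    by_cases hc : ∃ c ∈ 𝔖.sqC k, a ∈ 𝔖.C c
    · exact Or.inr hc
    · push Not at hc
      exact Or.inl ⟨h, hc⟩
  · rintro (⟨h, -⟩ | ⟨c, hc, hac⟩)
    · exact h
    · exact fun h => h.not_mem (C_subset_gen (mem_sqC_iff.1 hc).1 hac)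

/-- **The outside of the filling is 4-connected** (it is the escaping component). [folklore] -/
theorem conn_compl_F (ha : a ∉ 𝔖.F k) (hb : b ∉ 𝔖.F k) : Conn (↑(𝔖.F k))ᶜ a b := by
  rw [mem_F_iff, not_not] at ha hb
  have h := conn_of_out ha hb
  refine h.head_induction (P := fun z => Conn (↑(𝔖.F k))ᶜ z b) conn_refl fun x y hx hy hxy hyb ih => ?_
  have hyo : Out (𝔖.gen k) y := Out.of_conn hyb hb
  have hxo : Out (𝔖.gen k) x := Out.of_conn (conn_single hx hy hxy) hyo
  refine (conn_single (show x ∈ (↑(𝔖.F k) : Set (ℤ × ℤ))ᶜ from ?_) (show y ∈ (↑(𝔖.F k) : Set (ℤ × ℤ))ᶜ from ?_)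
    hxy).trans ih
  · exact fun h => (mem_F_iff.1 h) hxo
  · exact fun h => (mem_F_iff.1 h) hyo

/-- **Every excised core touches the outside of the filling.** [folklore] -/
theorem exists_oneStep_not_mem_F (hc : c ∈ 𝔖.sqC k) : ∃ x ∈ 𝔖.C c, ∃ y, OneStep x y ∧ y ∉ 𝔖.F k := by
  obtain ⟨-, x, hx, y, hxy, hy⟩ := mem_sqC_iff.1 hc
  exact ⟨x, hx, y, hxy, fun h => (mem_F_iff.1 h) hy⟩

/-- The window lies in the bounding box of the generator. [folklore] -/
theorem window_subset_bbox : 𝔖.window k ⊆ bbox (𝔖.gen k) := fun _ ha =>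
  fill_subset_bbox (Finset.mem_sdiff.1 ha).1

end StripData

end FineBlocks

end Literature.Probability.Percolation

end
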